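import Summits.Ventures.QEC.Census.CertChunks
import Summits.Ventures.QEC.Census.BB.BB72.Cert
import HarnessLib

/-!
# `BB72` — KERNEL-tier lower-bound replay, side Z, leaf file 4/10 (emitted by qec-search-7)

Bruteforce replay (CERT-FORMAT v1 §5.1, lemma L3) of the certificate `7e943c5a566adc43`: every Z-type operator of weight
`1 … 5` has nonzero syndrome (rows `cert.HX`) or is allow-listed (allow-list []). This file holds
9 packed chunk evaluations (`chunk1R`/`chunk2R` of `Census/CertChunks.lean` over `posList 72 cert.HX`), total
1491556 scan end points, each closed by `decide +kernel` — tier KERNEL (CERTIFIED): axioms ⊆ {propext, Classical.choice,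
Quot.sound}. Assembled in `BB/BB72/KernelZ.lean`. Do not edit; re-emit (HOME/census/search-7/emit_kernel.py).
-/

namespace Summit.Ventures.QEC.Census.BB72

/-- Level-2 chunks `(5, j)`, `0 ≤ j < 4`, side Z of `BB72` (171073 end points): pass. -/
theorem kZ2_5_0 : chunk2R (leafTest []) (posList 72 cert.HX) 3 5 0 4 = true := by decide +kernel

/-- Level-2 chunks `(5, j)`, `4 ≤ j < 9`, side Z of `BB72` (171695 end points): pass. -/
theorem kZ2_5_4 : chunk2R (leafTest []) (posList 72 cert.HX) 3 5 4 5 = true := by decide +kernel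

/-- Level-2 chunks `(5, j)`, `9 ≤ j < 17`, side Z of `BB72` (194398 end points): pass. -/
theorem kZ2_5_9 : chunk2R (leafTest []) (posList 72 cert.HX) 3 5 9 8 = true := by decide +kernel

/-- Level-2 chunks `(5, j)`, `17 ≤ j < 36`, side Z of `BB72` (199595 end points): pass. -/
theorem kZ2_5_17 : chunk2R (leafTest []) (posList 72 cert.HX) 3 5 17 19 = true := by decide +kernel

/-- Level-2 chunks `(5, j)`, `36 ≤ j < 66`, side Z of `BB72` (31930 end points): pass. -/
theorem kZ2_5_36 : chunk2R (leafTest []) (posList 72 cert.HX) 3 5 36 30 = true := by decide +kernel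

/-- Level-2 chunks `(6, j)`, `0 ≤ j < 5`, side Z of `BB72` (199180 end points): pass. -/
theorem kZ2_6_0 : chunk2R (leafTest []) (posList 72 cert.HX) 3 6 0 5 = true := by decide +kernel

/-- Level-2 chunks `(6, j)`, `5 ≤ j < 11`, side Z of `BB72` (181145 end points): pass. -/
theorem kZ2_6_5 : chunk2R (leafTest []) (posList 72 cert.HX) 3 6 5 6 = true := by decide +kernel

/-- Level-2 chunks `(6, j)`, `11 ≤ j < 21`, side Z of `BB72` (192555 end points): pass. -/
theorem kZ2_6_11 : chunk2R (leafTest []) (posList 72 cert.HX) 3 6 11 10 = true := by decide +kernel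

/-- Level-2 chunks `(6, j)`, `21 ≤ j < 65`, side Z of `BB72` (149985 end points): pass. -/
theorem kZ2_6_21 : chunk2R (leafTest []) (posList 72 cert.HX) 3 6 21 44 = true := by decide +kernel

end Summit.Ventures.QEC.Census.BB72
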